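import Mathlib
import HarnessLib
import Summits.HubbardSuperconductivity.HubbardSuperconductivity.Theorems.KLProgrammeSalmhoferCutoffDerivBound

/-!
# Route `KLProgramme` — engine support: an EXPLICIT bound on the SECOND derivative of Salmhofer's cutoff, `|χ₂″| ≤ (448/3)e² (< 1110)`

Cell `gate-hubbard-kl`, seat hubbard-kl-k3c2-p3 (row «sector-counting import (DR2000 L11/L12) for the leg-dress bar»), gen-4 ENGINE child
stmt-HubbardSuperconductivity-19855 (`stub_engine_step_norms`).  Companion of k3c2-p2's `KLProgrammeSalmhoferCutoffDerivBound` (`|χ₂′| ≤ 8e²`, sharp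
`32/3`): every constant of the `ℓ²`-route propagator bounds (`(32B₂ + 144B₁ + 128)c/Λ³` in Literature `HubbardSliceSymbolSmooth`, hence `α_n`,
k3c4-p2's scale-0 `α`, p5's R0 bounds) carries `B₂ = sup|χ₂″|`, for which the tree has only `∃ B₂` (`exists_deriv_bounds_salmhoferCutoff`).
With the logistic form `σ = smoothTransition = (1+E)⁻¹`, `E = exp(x⁻¹ − (1−x)⁻¹)` on `(0,1)` one has `σ′ = σ(1−σ)·h`, `h = x⁻² + (1−x)⁻²`, hence
`σ″ = σ(1−σ)[(1−2σ)h² + h′]` and `|σ″| ≤ σ(1−σ)(h² + |h′|) ≤ 84e²` (`σ(1−σ) = E/(1+E)² ≤ min(E, E⁻¹)`, `uᵏe^{−u} ≤ k!`); so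
**`klsd_abs_deriv2_smoothTransition_le`**: `|smoothTransition″| ≤ 84e²` on `ℝ` and **`klsd_abs_deriv2_salmhoferCutoff_le`**: `|χ₂″| ≤ (448/3)e²`
(`klsd_abs_deriv2_salmhoferCutoff_lt`: `< 1110`).  Everything is proved; no definitions. [folklore]

## Sources

M. Salmhofer, *Renormalization* (1999), §4.2.5 (4.70)–(4.71) (`Salmhofer1999`).
-/

noncomputable section

namespace Summit.HubbardSuperconductivity.HubbardSuperconductivity.Theorems.KLRegimeSplit

set_option linter.dupNamespace false -- summit = problem name (single-conjunct summit), D-0017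

open Real Set Filter Literature.MathematicalPhysics.QuantumLattice
open scoped Topology

/-! ## §1 Elementary bounds -/

/-- `uᵏ·e^{−u} ≤ k!` for `u ≥ 0`. [folklore] -/
theorem klsd_pow_mul_exp_neg_le (k : ℕ) {u : ℝ} (hu : 0 ≤ u) : u ^ k * Real.exp (-u) ≤ (Nat.factorial k : ℝ) := by
  have h := Real.pow_div_factorial_le_exp u hu k
  have hk : (0 : ℝ) < Nat.factorial k := by exact_mod_cast Nat.factorial_pos k
  rw [div_le_iff₀ hk] at h
  rw [Real.exp_neg, ← div_eq_mul_inv, div_le_iff₀ (Real.exp_pos u)]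
  linarith

/-- `E/(1+E)² ≤ E⁻¹` and `E/(1+E)² ≤ E` for `E > 0`. [folklore] -/
theorem klsd_logistic_weight_le {E : ℝ} (hE : 0 < E) : E / (1 + E) ^ 2 ≤ E⁻¹ ∧ E / (1 + E) ^ 2 ≤ E := by
  constructor
  · rw [div_le_iff₀ (by positivity), ← div_eq_inv_mul, le_div_iff₀ hE]; nlinarith
  · rw [div_le_iff₀ (by positivity)]
    have h1 : (1 : ℝ) ≤ (1 + E) ^ 2 := by nlinarith
    nlinarith

/-- **The core bound**: for `u, w > 0` with `u ≤ 2 ∨ w ≤ 2` and `E = exp(u − w)`,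
`E/(1+E)²·((u²+w²)² + (2u³ + 2w³)) ≤ 84e²`. [folklore] -/
theorem klsd_core_bound {u w : ℝ} (hu : 0 < u) (hw : 0 < w) (h : u ≤ 2 ∨ w ≤ 2) :
    Real.exp (u - w) / (1 + Real.exp (u - w)) ^ 2 * ((u ^ 2 + w ^ 2) ^ 2 + (2 * u ^ 3 + 2 * w ^ 3)) ≤ 84 * Real.exp 2 := by
  have hE : 0 < Real.exp (u - w) := Real.exp_pos _
  have hpoly0 : 0 ≤ (u ^ 2 + w ^ 2) ^ 2 + (2 * u ^ 3 + 2 * w ^ 3) := by positivity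
  -- the polynomial bound `e^{-t}(t⁴ + 2t³ + 8t² + 32) ≤ 84` for `t ≥ 0`
  have hP : ∀ t : ℝ, 0 ≤ t → Real.exp (-t) * (t ^ 4 + 2 * t ^ 3 + 8 * t ^ 2 + 32) ≤ 84 := by
    intro t ht
    have h4 := klsd_pow_mul_exp_neg_le 4 ht
    have h3 := klsd_pow_mul_exp_neg_le 3 ht
    have h2 := klsd_pow_mul_exp_neg_le 2 ht
    have h0 : Real.exp (-t) ≤ 1 := by rw [Real.exp_le_one_iff]; linarith
    simp only [Nat.factorial] at h4 h3 h2
    push_cast at h4 h3 h2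
    nlinarith [Real.exp_pos (-t)]
  rcases h with hu2 | hw2
  · -- `u ≤ 2`: `E/(1+E)² ≤ E = e^{u-w} ≤ e²·e^{-w}`, polynomial in `w`
    have hw' : (u ^ 2 + w ^ 2) ^ 2 + (2 * u ^ 3 + 2 * w ^ 3) ≤ w ^ 4 + 2 * w ^ 3 + 8 * w ^ 2 + 32 := by
      have hu4 : u ^ 2 ≤ 4 := by nlinarith
      have hu3 : u ^ 3 ≤ 8 := by nlinarith
      nlinarith [sq_nonneg w, pow_nonneg hw.le 2]
    have hwt := (klsd_logistic_weight_le hE).2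
    have hE' : Real.exp (u - w) ≤ Real.exp 2 * Real.exp (-w) := by
      rw [← Real.exp_add]; exact Real.exp_le_exp.2 (by linarith)
    calc _ ≤ Real.exp (u - w) * (w ^ 4 + 2 * w ^ 3 + 8 * w ^ 2 + 32) :=
          mul_le_mul hwt hw' hpoly0 hE.le
      _ ≤ (Real.exp 2 * Real.exp (-w)) * (w ^ 4 + 2 * w ^ 3 + 8 * w ^ 2 + 32) :=
          mul_le_mul_of_nonneg_right hE' (by positivity)
      _ = Real.exp 2 * (Real.exp (-w) * (w ^ 4 + 2 * w ^ 3 + 8 * w ^ 2 + 32)) := by ring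
      _ ≤ Real.exp 2 * 84 := mul_le_mul_of_nonneg_left (hP w hw.le) (Real.exp_pos 2).le
      _ = 84 * Real.exp 2 := by ring
  · -- `w ≤ 2`: `E/(1+E)² ≤ E⁻¹ = e^{w-u} ≤ e²·e^{-u}`, polynomial in `u`
    have hu' : (u ^ 2 + w ^ 2) ^ 2 + (2 * u ^ 3 + 2 * w ^ 3) ≤ u ^ 4 + 2 * u ^ 3 + 8 * u ^ 2 + 32 := by
      have hw4 : w ^ 2 ≤ 4 := by nlinarith
      have hw3 : w ^ 3 ≤ 8 := by nlinarith
      nlinarith [sq_nonneg u, pow_nonneg hu.le 2]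
    have hwt := (klsd_logistic_weight_le hE).1
    have hE' : (Real.exp (u - w))⁻¹ ≤ Real.exp 2 * Real.exp (-u) := by
      rw [← Real.exp_neg, ← Real.exp_add]; exact Real.exp_le_exp.2 (by linarith)
    calc _ ≤ (Real.exp (u - w))⁻¹ * (u ^ 4 + 2 * u ^ 3 + 8 * u ^ 2 + 32) :=
          mul_le_mul hwt hu' hpoly0 (by positivity)
      _ ≤ (Real.exp 2 * Real.exp (-u)) * (u ^ 4 + 2 * u ^ 3 + 8 * u ^ 2 + 32) :=
          mul_le_mul_of_nonneg_right hE' (by positivity)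
      _ = Real.exp 2 * (Real.exp (-u) * (u ^ 4 + 2 * u ^ 3 + 8 * u ^ 2 + 32)) := by ring
      _ ≤ Real.exp 2 * 84 := mul_le_mul_of_nonneg_left (hP u hu.le) (Real.exp_pos 2).le
      _ = 84 * Real.exp 2 := by ring

/-! ## §2 The second derivative of the logistic form on `(0,1)` -/

/-- On `(0,1)` the first derivative of `smoothTransition` is the logistic expression `E·h/(1+E)²`. [folklore] -/
theorem klsd_deriv_smoothTransition_eq {y : ℝ} (h0 : 0 < y) (h1 : y < 1) :
    deriv Real.smoothTransition y =
      Real.exp (y⁻¹ - (1 - y)⁻¹) * ((y⁻¹) ^ 2 + ((1 - y)⁻¹) ^ 2) / (1 + Real.exp (y⁻¹ - (1 - y)⁻¹)) ^ 2 := by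
  have hev : Real.smoothTransition =ᶠ[𝓝 y] fun z : ℝ => (1 + Real.exp (z⁻¹ - (1 - z)⁻¹))⁻¹ := by
    filter_upwards [Ioo_mem_nhds h0 h1] with z hz
    exact klcd_smoothTransition_eq_logistic hz.1 hz.2
  exact ((klcd_hasDerivAt_logistic h0 h1).congr_of_eventuallyEq hev).deriv

/-- The logistic weight in product form: `E/(1+E)² = s(1−s)`, `s = (1+E)⁻¹`. [folklore] -/
theorem klsd_weight_eq_logistic (E : ℝ) (hE : 0 < E) : E / (1 + E) ^ 2 = (1 + E)⁻¹ * (1 - (1 + E)⁻¹) := by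
  have h1 : (1 + E) ≠ 0 := by positivity
  field_simp
  ring

/-- **`|smoothTransition″| ≤ 84e²` on `(0,1)`**, through `σ′ = σ(1−σ)h` ⇒ `σ″ = σ(1−σ)[(1−2σ)h² + h′]`. [folklore] -/
theorem klsd_abs_deriv2_smoothTransition_le_of_mem_Ioo {x : ℝ} (h0 : 0 < x) (h1 : x < 1) :
    |deriv (deriv Real.smoothTransition) x| ≤ 84 * Real.exp 2 := by
  have h1' : 0 < 1 - x := by linarith
  have hx0 : x ≠ 0 := h0.ne'
  have hx1 : (1 - x) ≠ 0 := h1'.ne'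
  -- the three functions `s`, `hh`, `L = s(1-s)·hh`
  set s : ℝ → ℝ := fun y => (1 + Real.exp (y⁻¹ - (1 - y)⁻¹))⁻¹ with hs
  set hh : ℝ → ℝ := fun y => (y⁻¹) ^ 2 + ((1 - y)⁻¹) ^ 2 with hhh
  set Lf : ℝ → ℝ := fun y => Real.exp (y⁻¹ - (1 - y)⁻¹) * ((y⁻¹) ^ 2 + ((1 - y)⁻¹) ^ 2) / (1 + Real.exp (y⁻¹ - (1 - y)⁻¹)) ^ 2
    with hLf
  have hLeq : ∀ y, Lf y = s y * (1 - s y) * hh y := by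
    intro y
    simp only [hLf, hs, hhh]
    rw [mul_div_right_comm, klsd_weight_eq_logistic _ (Real.exp_pos _)]
  -- `deriv smoothTransition = L = s(1-s)hh` near `x`
  have hev : deriv Real.smoothTransition =ᶠ[𝓝 x] fun y => s y * (1 - s y) * hh y := by
    filter_upwards [Ioo_mem_nhds h0 h1] with y hy
    rw [klsd_deriv_smoothTransition_eq hy.1 hy.2, ← hLeq y]
  -- derivatives of `s` and `hh` at `x`
  have hsd : HasDerivAt s (Lf x) x := klcd_hasDerivAt_logistic h0 h1
  have hhd : HasDerivAt hh (2 * x⁻¹ * (-(x ^ 2)⁻¹) + 2 * (1 - x)⁻¹ * ((1 - x) ^ 2)⁻¹) x := by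
    have hv1 : HasDerivAt (fun y : ℝ => y⁻¹) (-(x ^ 2)⁻¹) x := hasDerivAt_inv hx0
    have hv2 : HasDerivAt (fun y : ℝ => (1 - y)⁻¹) (((1 - x) ^ 2)⁻¹) x := by
      have hl : HasDerivAt (fun y : ℝ => 1 - y) (-1) x := (hasDerivAt_id' x).const_sub 1
      exact (hl.inv hx1).congr_deriv (by rw [neg_neg, one_div])
    have h := (hv1.pow 2).add (hv2.pow 2)
    refine h.congr_deriv ?_
    norm_num
  have hprod : HasDerivAt (fun y => s y * (1 - s y) * hh y)
      ((Lf x * (1 - s x) + s x * (-Lf x)) * hh x +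
        s x * (1 - s x) * (2 * x⁻¹ * (-(x ^ 2)⁻¹) + 2 * (1 - x)⁻¹ * ((1 - x) ^ 2)⁻¹)) x := by
    have h1s : HasDerivAt (fun y => 1 - s y) (-Lf x) x := hsd.const_sub 1
    exact (hsd.mul h1s).mul hhd
  have hD2 := hprod.congr_of_eventuallyEq hev
  rw [hD2.deriv]
  -- sizes: `0 ≤ s ≤ 1`, `s(1-s) = E/(1+E)²`, `|hh′| ≤ 2u³ + 2w³`
  set u : ℝ := x⁻¹ with hu
  set w : ℝ := (1 - x)⁻¹ with hw
  have hupos : 0 < u := inv_pos.2 h0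
  have hwpos : 0 < w := inv_pos.2 h1'
  have hE : 0 < Real.exp (u - w) := Real.exp_pos _
  have hs0 : 0 ≤ s x := by simp only [hs]; positivity
  have hs1 : s x ≤ 1 := by
    simp only [hs]
    exact inv_le_one_of_one_le₀ (by linarith [Real.exp_pos (x⁻¹ - (1 - x)⁻¹)])
  have hwt : s x * (1 - s x) = Real.exp (u - w) / (1 + Real.exp (u - w)) ^ 2 := by
    simp only [hs, hu, hw]; rw [klsd_weight_eq_logistic _ (Real.exp_pos _)]
  have hwt0 : 0 ≤ s x * (1 - s x) := mul_nonneg hs0 (by linarith)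
  have hLx : Lf x = s x * (1 - s x) * hh x := hLeq x
  have hhx : hh x = u ^ 2 + w ^ 2 := by simp only [hhh, hu, hw]
  have hhx0 : 0 ≤ hh x := by rw [hhx]; positivity
  have hhd_eq : 2 * x⁻¹ * (-(x ^ 2)⁻¹) + 2 * (1 - x)⁻¹ * ((1 - x) ^ 2)⁻¹ = -2 * u ^ 3 + 2 * w ^ 3 := by
    simp only [hu, hw]; rw [← inv_pow, ← inv_pow]; ring
  rw [hhd_eq, hLx]
  -- `σ″ = s(1-s)·[(1-2s)·hh² + hh′]`
  have hform : (s x * (1 - s x) * hh x * (1 - s x) + s x * -(s x * (1 - s x) * hh x)) * hh x +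
      s x * (1 - s x) * (-2 * u ^ 3 + 2 * w ^ 3) =
      s x * (1 - s x) * ((1 - 2 * s x) * hh x ^ 2 + (-2 * u ^ 3 + 2 * w ^ 3)) := by ring
  rw [hform, abs_mul, abs_of_nonneg hwt0]
  have h12 : |1 - 2 * s x| ≤ 1 := by rw [abs_le]; constructor <;> linarith
  have hbr : |(1 - 2 * s x) * hh x ^ 2 + (-2 * u ^ 3 + 2 * w ^ 3)| ≤ (u ^ 2 + w ^ 2) ^ 2 + (2 * u ^ 3 + 2 * w ^ 3) := by
    refine (abs_add_le _ _).trans (add_le_add ?_ ?_)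
    · rw [abs_mul, hhx]
      calc |1 - 2 * s x| * |(u ^ 2 + w ^ 2) ^ 2| ≤ 1 * |(u ^ 2 + w ^ 2) ^ 2| :=
            mul_le_mul_of_nonneg_right h12 (abs_nonneg _)
        _ = (u ^ 2 + w ^ 2) ^ 2 := by rw [one_mul, abs_of_nonneg (by positivity)]
    · rw [abs_le]; constructor <;> nlinarith [pow_pos hupos 3, pow_pos hwpos 3]
  have hcase : u ≤ 2 ∨ w ≤ 2 := by
    rcases le_or_gt x (1 / 2) with hx | hx
    · right; rw [hw, inv_le_comm₀ h1' (by norm_num)]; linarith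
    · left; rw [hu, inv_le_comm₀ h0 (by norm_num)]; linarith
  calc s x * (1 - s x) * |(1 - 2 * s x) * hh x ^ 2 + (-2 * u ^ 3 + 2 * w ^ 3)|
      ≤ s x * (1 - s x) * ((u ^ 2 + w ^ 2) ^ 2 + (2 * u ^ 3 + 2 * w ^ 3)) := mul_le_mul_of_nonneg_left hbr hwt0
    _ = Real.exp (u - w) / (1 + Real.exp (u - w)) ^ 2 * ((u ^ 2 + w ^ 2) ^ 2 + (2 * u ^ 3 + 2 * w ^ 3)) := by rw [hwt]
    _ ≤ 84 * Real.exp 2 := klsd_core_bound hupos hwpos hcase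

/-! ## §3 Everywhere, and `χ₂″` -/

/-- **`|smoothTransition″| ≤ 84e²` on all of `ℝ`** (end points by continuity of the second derivative and density). [folklore] -/
theorem klsd_abs_deriv2_smoothTransition_le (x : ℝ) : |deriv (deriv Real.smoothTransition) x| ≤ 84 * Real.exp 2 := by
  -- off `[0,1]` the first derivative vanishes near the point, hence so does the second
  -- (cf. `Literature.Analysis.FluidPDE.Carleman.deriv_deriv_smoothTransition_of_neg/_of_one_lt`, not imported here)
  have hneg : ∀ y : ℝ, y < 0 → deriv (deriv Real.smoothTransition) y = 0 := by
    intro y hy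
    have hev : deriv Real.smoothTransition =ᶠ[𝓝 y] fun _ => (0 : ℝ) := by
      filter_upwards [Iio_mem_nhds hy] with z hz
      exact klcd_deriv_smoothTransition_eq_zero_of_neg hz
    rw [hev.deriv_eq]; simp
  have hone : ∀ y : ℝ, 1 < y → deriv (deriv Real.smoothTransition) y = 0 := by
    intro y hy
    have hev : deriv Real.smoothTransition =ᶠ[𝓝 y] fun _ => (0 : ℝ) := by
      filter_upwards [Ioi_mem_nhds hy] with z hz
      have hev' : Real.smoothTransition =ᶠ[𝓝 z] fun _ => (1 : ℝ) := by
        filter_upwards [Ioi_mem_nhds hz] with t ht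
        exact Real.smoothTransition.one_of_one_le ht.le
      rw [hev'.deriv_eq]; simp
    rw [hev.deriv_eq]; simp
  have hD : ∀ y ∈ ({0}ᶜ ∩ {1}ᶜ : Set ℝ), |deriv (deriv Real.smoothTransition) y| ≤ 84 * Real.exp 2 := by
    intro y hy
    have hy0 : y ≠ 0 := hy.1
    have hy1 : y ≠ 1 := hy.2
    rcases lt_or_gt_of_ne hy0 with h | h
    · rw [hneg y h, abs_zero]; positivity
    · rcases lt_or_gt_of_ne hy1 with h' | h'
      · exact klsd_abs_deriv2_smoothTransition_le_of_mem_Ioo h h'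
      · rw [hone y h', abs_zero]; positivity
  have hdense : Dense ({0}ᶜ ∩ {1}ᶜ : Set ℝ) :=
    (dense_compl_singleton 0).inter_of_isOpen_left (dense_compl_singleton 1) isOpen_compl_singleton
  have hcont : Continuous fun y => |deriv (deriv Real.smoothTransition) y| := by
    have h2 : Continuous (iteratedDeriv 2 Real.smoothTransition) :=
      (Real.smoothTransition.contDiff (n := 2)).continuous_iteratedDeriv 2 le_rfl
    have heq : iteratedDeriv 2 Real.smoothTransition = deriv (deriv Real.smoothTransition) := by
      rw [iteratedDeriv_succ, iteratedDeriv_one]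
    rw [heq] at h2
    exact h2.abs
  have hclosed : IsClosed {y : ℝ | |deriv (deriv Real.smoothTransition) y| ≤ 84 * Real.exp 2} :=
    isClosed_le hcont continuous_const
  have hsub : closure ({0}ᶜ ∩ {1}ᶜ : Set ℝ) ⊆ {y : ℝ | |deriv (deriv Real.smoothTransition) y| ≤ 84 * Real.exp 2} :=
    hclosed.closure_subset_iff.mpr hD
  rw [hdense.closure_eq] at hsub
  exact hsub (mem_univ x)

/-- The first derivative of `χ₂` as a function: `χ₂′(x) = (4/3)·σ′((4x−1)/3)`. [cite: Salmhofer1999, §4.2.5 (4.71)] -/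
theorem klsd_deriv_salmhoferCutoff_eq :
    deriv salmhoferCutoff = fun x => deriv Real.smoothTransition ((4 * x - 1) / 3) * (4 / 3) := by
  funext x
  have hℓ : HasDerivAt (fun y : ℝ => (4 * y - 1) / 3) (4 / 3) x := by
    have := ((hasDerivAt_id x).const_mul 4).sub_const 1
    have := this.div_const 3
    simpa using this
  have hs : HasDerivAt Real.smoothTransition (deriv Real.smoothTransition ((4 * x - 1) / 3)) ((4 * x - 1) / 3) :=
    ((Real.smoothTransition.contDiff (n := 1)).differentiable (by norm_num) _).hasDerivAt
  have hcomp : HasDerivAt salmhoferCutoff (deriv Real.smoothTransition ((4 * x - 1) / 3) * (4 / 3)) x :=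
    (hs.comp x hℓ).congr_of_eventuallyEq (Eventually.of_forall fun y => rfl)
  exact hcomp.deriv

/-- **`|χ₂″ x| ≤ (448/3)e²`** for Salmhofer's cutoff `χ₂(x) = smoothTransition((4x−1)/3)`. [cite: Salmhofer1999, §4.2.5 (4.71)] -/
theorem klsd_abs_deriv2_salmhoferCutoff_le (x : ℝ) : |deriv (deriv salmhoferCutoff) x| ≤ 448 / 3 * Real.exp 2 := by
  rw [klsd_deriv_salmhoferCutoff_eq]
  have hℓ : HasDerivAt (fun y : ℝ => (4 * y - 1) / 3) (4 / 3) x := by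
    have := ((hasDerivAt_id x).const_mul 4).sub_const 1
    have := this.div_const 3
    simpa using this
  have hdiff : Differentiable ℝ (deriv Real.smoothTransition) := by
    have h := (Real.smoothTransition.contDiff (n := 2)).differentiable_iteratedDeriv 1 (by norm_num)
    rwa [iteratedDeriv_one] at h
  have hs : HasDerivAt (deriv Real.smoothTransition) (deriv (deriv Real.smoothTransition) ((4 * x - 1) / 3)) ((4 * x - 1) / 3) :=
    (hdiff _).hasDerivAt
  have hcomp : HasDerivAt (fun y => deriv Real.smoothTransition ((4 * y - 1) / 3) * (4 / 3))
      (deriv (deriv Real.smoothTransition) ((4 * x - 1) / 3) * (4 / 3) * (4 / 3)) x :=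
    ((hs.comp x hℓ).congr_of_eventuallyEq (Eventually.of_forall fun y => rfl)).mul_const _
  rw [hcomp.deriv, abs_mul, abs_mul, abs_of_pos (by norm_num : (0:ℝ) < 4 / 3)]
  have := klsd_abs_deriv2_smoothTransition_le ((4 * x - 1) / 3)
  nlinarith [Real.exp_pos 2]

/-- Numeric form: `|χ₂″ x| < 1110` (`e² < 7.39`). [folklore] -/
theorem klsd_abs_deriv2_salmhoferCutoff_lt (x : ℝ) : |deriv (deriv salmhoferCutoff) x| < 1110 := by
  have h := klsd_abs_deriv2_salmhoferCutoff_le x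
  have he : Real.exp 1 < 2.7182818286 := Real.exp_one_lt_d9
  have he0 : 0 < Real.exp 1 := Real.exp_pos 1
  have h2 : Real.exp 2 = Real.exp 1 * Real.exp 1 := by rw [← Real.exp_add]; norm_num
  nlinarith

end Summit.HubbardSuperconductivity.HubbardSuperconductivity.Theorems.KLRegimeSplit

end
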